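import Literature.Probability.RandomPlanarGeometry.HexSAWBrickWallStrip
import Mathlib.Analysis.SpecialFunctions.Pow.Real
import Mathlib.Analysis.SpecialFunctions.Pow.Continuity
import HarnessLib

/-!
# Honeycomb strips with a surface fugacity: the partition functions `C_{T,n}(y,1)` and the growth rates `μ_T(y)`

Topic `Literature/Probability/RandomPlanarGeometry` (continues `HexSAWBrickWallStrip.lean` — the row strips
`S_T = ℤ × {0,…,T}` of the brick wall (honeycomb lattice), `HexBW.stripPairs T n` (starting site in the cross-section,
translate), `HexBW.stripCount`, `HexBW.stripConnectiveConstant`).  Source: N. R. Beaton, M. Bousquet-Mélou, J. de Gier,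
H. Duminil-Copin, A. J. Guttmann, *The critical fugacity for surface adsorption of self-avoiding walks on the honeycomb
lattice is `1 + √2`*, Comm. Math. Phys. 326 (2014), arXiv:1109.0358v5, §3.2 (pp. 10–11): "Let `c_{T,n}(i,j)` be the number of
`n`-step walks in a strip of height `T` with `i` vertices in the bottom line and `j` vertices in the top line … The
associated partition function is given by `C_{T,n}(y,z) = Σ_{i,j} c_{T,n}(i,j) y^i z^j`", Proposition 6 ("`lim C_{T,n}(y,z)^{1/n}
=: μ_T(y,z)` … `μ_T(y,z) = μ_T(z,y)`, and so, in particular, `μ_T(y,1) = μ_T(1,y)`") and Proposition 7 ("For `y > 0`,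
we have `μ_T(1,y) < μ_{T+1}(1,y)`").  Here the walks are the translation classes of `HexSAWBrickWallStrip.lean` (both
cosets, any start in the cross-section — not rooted at a mid-edge below the strip as printed; the growth rates agree by
the usual unfolding argument, which is not formalised here — except at `y = 1`, where `HexBW.stripMuY_one` of
`HexSAWBrickWallStripFugacityStrict.lean` identifies `μ_T(1)` with the tree's `HexBW.stripConnectiveConstant T`) and the
surface weight sits on the BOTTOM row `0`; "the strip `S_T`" is the lane's brick-wall strip of `T + 1` rows (no numerical
identification with the printed height is asserted).  The existence mechanism here is the OTHER printed one: Madras–Slade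
§8.2, (8.2.2)–(8.2.3) p. 267 (sub-multiplicativity over translation classes, then Lemma 1.2.2 p. 9), in weighted form.
Label (lane «pcv-sawmu», lit-1 gen 13): CONSOLIDATION of Proposition 6's existence statement by a different
(elsewhere-printed) proof.

## Main definitions and statements (namespace `Literature.Probability.RandomPlanarGeometry.SAW.HexBW`, all PROVED)

* `bottomVisits a υ n` (`= i`, the number of vertices of the placed walk in the bottom row), `stripZ T n y = C_{T,n}(y,1)`
  over translation classes, `yK y = max 1 y⁻¹`;
* **`stripZ_add_le`** — `C_{T,N+M}(y) ≤ max(1, y⁻¹) · C_{T,N}(y) · C_{T,M}(y)` (the split vertex is counted twice);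
* `stripMuY T y = μ_T(y,1) := inf_N (max(1,y⁻¹) C_{T,N}(y))^{1/N}`, **`tendsto_stripZ_rpow`** (`C_{T,n}(y)^{1/n} → μ_T(y)`,
  Fekete), `pow_stripMuY_le` (`μ_T(y)ⁿ ≤ max(1,y⁻¹) C_{T,n}(y)`), `stripMuY_pos`, `one_le_stripMuY_succ` (`1 ≤ μ_{T+1}(y)`),
  `stripMuY_mono` (nondecreasing in `T`).

The strict inequality of Proposition 7 for every `y > 0` is `HexSAWBrickWallStripFugacityStrict.lean`.
-/

noncomputable section

open Filter Topology Finset Literature.Probability.LatticeModels Literature.Probability.Percolation SimpleGraph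

namespace Literature.Probability.RandomPlanarGeometry.SAW.HexBW

/-! ### The bottom-row visit count and the partition function -/

/-- The number of vertices of the placed walk `m ↦ a + υ m`, `m ≤ n`, in the bottom row `x₁ = 0` (the printed `i` of
`c_{T,n}(i,j)`). [cite: BeatonBousquetMelouDeGierDuminilCopinGuttmann2014, §3.2 (arXiv v5 p. 11: c_{T,n}(i,j), i vertices in the bottom line)] -/
def bottomVisits (a : Site 2) (υ : ℕ → Site 2) (n : ℕ) : ℕ :=
  ∑ m ∈ Finset.range (n + 1), if (a + υ m) 1 = 0 then 1 else 0

/-- **`C_{T,n}(y,1)`**: the partition function of the `n`-step walks of the strip `S_T` (translation classes) with a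
fugacity `y` per vertex in the bottom row. [cite: BeatonBousquetMelouDeGierDuminilCopinGuttmann2014, §3.2 (arXiv v5 p. 11: C_{T,n}(y,z) = Σ c_{T,n}(i,j) y^i z^j)] -/
def stripZ (T n : ℕ) (y : ℝ) : ℝ := ∑ p ∈ stripPairs T n, y ^ bottomVisits p.1 p.2 n

/-- The splitting constant `max(1, y⁻¹)` (the vertex shared by the two halves of a split walk is weighted twice).
[cite: BeatonBousquetMelouDeGierDuminilCopinGuttmann2014, Proposition 6 (arXiv v5 p. 10: existence of μ_T by concatenation)] -/
def yK (y : ℝ) : ℝ := max 1 y⁻¹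

/-- `bottomVisits ≤ n + 1`. [cite: BeatonBousquetMelouDeGierDuminilCopinGuttmann2014, §3.2 (arXiv v5 p. 11)] -/
theorem bottomVisits_le (a : Site 2) (υ : ℕ → Site 2) (n : ℕ) : bottomVisits a υ n ≤ n + 1 := by
  unfold bottomVisits
  calc ∑ m ∈ Finset.range (n + 1), (if (a + υ m) 1 = 0 then 1 else 0)
      ≤ ∑ _m ∈ Finset.range (n + 1), 1 := Finset.sum_le_sum fun m _ => by split_ifs <;> omega
    _ = n + 1 := by simp

/-- `1 ≤ max(1, y⁻¹)`. [cite: BeatonBousquetMelouDeGierDuminilCopinGuttmann2014, Proposition 6 (arXiv v5 p. 10)] -/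
theorem one_le_yK (y : ℝ) : 1 ≤ yK y := le_max_left _ _

/-- `y⁻¹ ≤ max(1, y⁻¹)`. [cite: BeatonBousquetMelouDeGierDuminilCopinGuttmann2014, Proposition 6 (arXiv v5 p. 10)] -/
theorem inv_le_yK (y : ℝ) : y⁻¹ ≤ yK y := le_max_right _ _

/-- `0 < C_{T,n}(y)` for `y > 0`. [cite: BeatonBousquetMelouDeGierDuminilCopinGuttmann2014, §3.2 (arXiv v5 p. 11)] -/
theorem stripZ_pos (T n : ℕ) {y : ℝ} (hy : 0 < y) : 0 < stripZ T n y := by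
  unfold stripZ
  have hne : (stripPairs T n).Nonempty := Finset.card_pos.1 (one_le_stripCount T n)
  exact Finset.sum_pos (fun p _ => pow_pos hy _) hne

/-- **`min(1,y)^{n+1} ≤ C_{T,n}(y)`**: the straight walk along the bottom row alone. [cite: BeatonBousquetMelouDeGierDuminilCopinGuttmann2014, §3.2 (arXiv v5 p. 11)] -/
theorem min_pow_le_stripZ (T n : ℕ) {y : ℝ} (hy : 0 < y) : (min 1 y) ^ (n + 1) ≤ stripZ T n y := by
  have hsw := mem_saws.1 (straightWalk_mem n)
  have hmem : ((0 : Site 2), Zd.straightWalk 2 n) ∈ stripPairs T n :=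
    mem_stripPairs.2 ⟨zero_mem_stripStarts T, hsw.1, fun i hi => by simpa only [zero_add] using hsw.2 i hi,
      fun m _ => by
        simp only [zero_add, InStrip, Zd.straightWalk, Pi.single_eq_of_ne (one_ne_zero : (1 : Fin 2) ≠ 0)]
        exact ⟨le_rfl, by positivity⟩⟩
  have hmin0 : 0 ≤ min 1 y := le_min zero_le_one hy.le
  have hterm : (min 1 y) ^ (n + 1) ≤ y ^ bottomVisits (0 : Site 2) (Zd.straightWalk 2 n) n := by
    have hV := bottomVisits_le (0 : Site 2) (Zd.straightWalk 2 n) n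
    rcases le_or_gt 1 y with h1 | h1
    · rw [min_eq_left h1, one_pow]; exact one_le_pow₀ h1
    · rw [min_eq_right h1.le]; exact pow_le_pow_of_le_one hy.le h1.le hV
  unfold stripZ
  exact hterm.trans (Finset.single_le_sum (f := fun p => y ^ bottomVisits p.1 p.2 n)
    (fun p _ => pow_nonneg hy.le _) hmem)

/-- For `T ≥ 1` the straight walk along the row `1` has no bottom vertex: **`1 ≤ C_{T,n}(y)`**.
[cite: BeatonBousquetMelouDeGierDuminilCopinGuttmann2014, §3.2 (arXiv v5 p. 11)] -/
theorem one_le_stripZ {T : ℕ} (hT : 1 ≤ T) (n : ℕ) {y : ℝ} (hy : 0 < y) : 1 ≤ stripZ T n y := by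
  have hsw := mem_saws.1 (straightWalk_mem n)
  set a : Site 2 := Pi.single 1 1 with ha
  have ha0 : a 0 = 0 := by rw [ha]; simp
  have ha1 : a 1 = 1 := by rw [ha]; simp
  have hrow : ∀ m, (a + Zd.straightWalk 2 n m) 1 = 1 := fun m => by
    simp only [Pi.add_apply, ha1, Zd.straightWalk, Pi.single_eq_of_ne (one_ne_zero : (1 : Fin 2) ≠ 0)]; ring
  have hx : ∀ m, (a + Zd.straightWalk 2 n m) 0 = ((min m n : ℕ) : ℤ) := fun m => by
    simp only [Pi.add_apply, ha0, Zd.straightWalk, Pi.single_eq_same, zero_add]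
  have hmem : (a, Zd.straightWalk 2 n) ∈ stripPairs T n := by
    refine mem_stripPairs.2 ⟨?_, hsw.1, fun i hi => ?_, fun m _ => ?_⟩
    · show a ∈ stripStarts T
      exact mem_stripStarts.2 ⟨⟨by rw [ha0], by rw [ha0]; norm_num⟩, by
        show 0 ≤ a 1 ∧ a 1 ≤ (T : ℤ); rw [ha1]; exact ⟨by norm_num, by exact_mod_cast hT⟩⟩
    · show brickWallGraph.Adj (a + Zd.straightWalk 2 n i) (a + Zd.straightWalk 2 n (i + 1))
      rw [brickWallGraph_adj_coord, hx, hx, hrow, hrow, min_eq_left hi.le, min_eq_left (by omega : i + 1 ≤ n)]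
      left; exact ⟨Or.inl (by push_cast; ring), rfl⟩
    · show 0 ≤ (a + Zd.straightWalk 2 n m) 1 ∧ (a + Zd.straightWalk 2 n m) 1 ≤ (T : ℤ)
      rw [hrow]; exact ⟨by norm_num, by exact_mod_cast hT⟩
  have hterm : (1 : ℝ) ≤ y ^ bottomVisits a (Zd.straightWalk 2 n) n := by
    have : bottomVisits a (Zd.straightWalk 2 n) n = 0 := by
      unfold bottomVisits
      exact Finset.sum_eq_zero fun m _ => by rw [if_neg (by rw [hrow]; norm_num)]
    rw [this, pow_zero]
  unfold stripZ
  exact hterm.trans (Finset.single_le_sum (f := fun p => y ^ bottomVisits p.1 p.2 n)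
    (fun p _ => pow_nonneg hy.le _) hmem)

/-! ### Submultiplicativity with the surface weight -/

/-- The splitting map of (8.2.2): first `N` steps, then the last `M` steps translated back to the cross-section.
[cite: MadrasSlade1993, §8.2, eq. (8.2.2), p. 268] -/
def split (N M : ℕ) (p : Site 2 × (ℕ → Site 2)) : (Site 2 × (ℕ → Site 2)) × (Site 2 × (ℕ → Site 2)) :=
  ((p.1, fun i => p.2 (min i N)), (snorm (p.1 + p.2 N), fun i => p.2 (N + min i M) - p.2 N))

/-- The two halves of a walk of `S_T` are walks of `S_T`. [cite: MadrasSlade1993, §8.2, eq. (8.2.2), p. 268] -/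
theorem split_mem {T N M : ℕ} {p : Site 2 × (ℕ → Site 2)} (hp : p ∈ stripPairs T (N + M)) :
    split N M p ∈ stripPairs T N ×ˢ stripPairs T M := by
  classical
  obtain ⟨a, ω⟩ := p
  rw [mem_stripPairs] at hp
  obtain ⟨ha, hω, hbw, hR⟩ := hp
  obtain ⟨h0, hend, hadj, hinj⟩ := Zd.mem_saws.1 hω
  rw [split, Finset.mem_product, mem_stripPairs, mem_stripPairs]
  refine ⟨⟨ha, Zd.mem_saws.2 ⟨by simpa using h0, ?_, ?_, ?_⟩, ?_, ?_⟩,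
    snorm_mem_stripStarts (hR N (Nat.le_add_right N M)), Zd.mem_saws.2 ⟨by simp, ?_, ?_, ?_⟩, ?_, ?_⟩
  · intro i hi
    simp [min_eq_right hi]
  · intro i hi
    have h1 : min i N = i := min_eq_left hi.le
    have h2 : min (i + 1) N = i + 1 := min_eq_left (by omega)
    simp only [h1, h2]
    exact hadj i (by omega)
  · intro i hi j hj hij
    simp only [Set.mem_setOf_eq] at hi hj
    simp only [min_eq_left hi, min_eq_left hj] at hij
    exact hinj (by simp only [Set.mem_setOf_eq]; omega)
      (by simp only [Set.mem_setOf_eq]; omega) hij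
  · intro i hi
    have h1 : min i N = i := min_eq_left hi.le
    have h2 : min (i + 1) N = i + 1 := min_eq_left (by omega)
    simp only [h1, h2]
    exact hbw i (by omega)
  · intro m hm
    simp only [min_eq_left hm]
    exact hR m (by omega)
  · intro i hi
    simp [min_eq_right hi]
  · intro i hi
    have h1 : min i M = i := min_eq_left hi.le
    have h2 : min (i + 1) M = i + 1 := min_eq_left (by omega)
    simp only [h1, h2]
    rw [Zd.zdGraph_adj_sub_right, ← add_assoc]
    exact hadj (N + i) (by omega)
  · intro i hi j hj hij
    simp only [Set.mem_setOf_eq] at hi hj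
    simp only [min_eq_left hi, min_eq_left hj, sub_left_inj] at hij
    have := hinj (by simp only [Set.mem_setOf_eq]; omega)
      (by simp only [Set.mem_setOf_eq]; omega) hij
    omega
  · intro i hi
    have h1 : min i M = i := min_eq_left hi.le
    have h2 : min (i + 1) M = i + 1 := min_eq_left (by omega)
    simp only [h1, h2]
    have key : brickWallGraph.Adj (a + ω (N + i)) (a + ω (N + i + 1)) := hbw (N + i) (by omega)
    have e1 : a + ω N - snorm (a + ω N) + (snorm (a + ω N) + (ω (N + i) - ω N)) =
        a + ω (N + i) := by abel
    have e2 : a + ω N - snorm (a + ω N) + (snorm (a + ω N) + (ω (N + (i + 1)) - ω N)) =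
        a + ω (N + i + 1) := by rw [← add_assoc N i 1]; abel
    rw [← adj_add_left_iff_of_even (snorm_shift_even (a + ω N)), e1, e2]
    exact key
  · intro m hm
    simp only [min_eq_left hm]
    have hin := hR (N + m) (by omega)
    refine ⟨?_, ?_⟩
    · have := hin.1
      simp only [Pi.add_apply, Pi.sub_apply, snorm_apply_one] at this ⊢
      linarith
    · have := hin.2
      simp only [Pi.add_apply, Pi.sub_apply, snorm_apply_one] at this ⊢
      linarith

/-- The splitting map is injective on the walks of `S_T`. [cite: MadrasSlade1993, §8.2, eq. (8.2.2), p. 268] -/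
theorem split_injOn (T N M : ℕ) : Set.InjOn (split N M) ↑(stripPairs T (N + M)) := by
  rintro ⟨a, ω⟩ hp ⟨a', ω'⟩ hp' h
  rw [Finset.mem_coe, mem_stripPairs] at hp hp'
  dsimp only at hp hp'
  have hω := Zd.mem_saws.1 hp.2.1
  have hω' := Zd.mem_saws.1 hp'.2.1
  simp only [split, Prod.mk.injEq] at h
  obtain ⟨⟨rfl, h1⟩, -, h2⟩ := h
  simp only [Prod.mk.injEq, true_and]
  have hn : ω N = ω' N := by simpa using congrFun h1 N
  funext i
  rcases le_or_gt i N with hi | hi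
  · simpa [min_eq_left hi] using congrFun h1 i
  · obtain ⟨j, rfl⟩ : ∃ j, i = N + j := ⟨i - N, by omega⟩
    rcases le_or_gt j M with hj | hj
    · have := congrFun h2 j
      simp only [min_eq_left hj] at this
      rwa [hn, sub_left_inj] at this
    · have := congrFun h2 M
      simp only [min_self] at this
      rw [hn, sub_left_inj] at this
      rw [hω.2.1 (N + j) (by omega), hω'.2.1 (N + j) (by omega), this]

/-- The bottom vertices of a walk are those of its two halves, the split vertex counted twice.
[cite: BeatonBousquetMelouDeGierDuminilCopinGuttmann2014, Proposition 6 (arXiv v5 p. 10: concatenation)] -/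
theorem bottomVisits_split (a : Site 2) (ω : ℕ → Site 2) (N M : ℕ) :
    bottomVisits a ω (N + M) + (if (a + ω N) 1 = 0 then 1 else 0) =
      bottomVisits (split N M (a, ω)).1.1 (split N M (a, ω)).1.2 N +
        bottomVisits (split N M (a, ω)).2.1 (split N M (a, ω)).2.2 M := by
  unfold bottomVisits split
  simp only
  have e1 : ∑ m ∈ Finset.range (N + 1), (if (a + ω (min m N)) 1 = 0 then 1 else 0) =
      ∑ m ∈ Finset.range (N + 1), (if (a + ω m) 1 = 0 then 1 else 0) :=
    Finset.sum_congr rfl fun m hm => by rw [min_eq_left (Nat.lt_succ_iff.1 (Finset.mem_range.1 hm))]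
  have e2 : ∑ m ∈ Finset.range (M + 1),
      (if (snorm (a + ω N) + (ω (N + min m M) - ω N)) 1 = 0 then 1 else 0) =
      ∑ m ∈ Finset.range (M + 1), (if (a + ω (N + m)) 1 = 0 then 1 else 0) :=
    Finset.sum_congr rfl fun m hm => by
      rw [min_eq_left (Nat.lt_succ_iff.1 (Finset.mem_range.1 hm))]
      have : (snorm (a + ω N) + (ω (N + m) - ω N)) 1 = (a + ω (N + m)) 1 := by
        simp only [Pi.add_apply, Pi.sub_apply, snorm_apply_one]; ring
      rw [this]
  rw [e1, e2, show N + M + 1 = (N + 1) + M by ring, Finset.sum_range_add, Finset.sum_range_succ' (n := M)]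
  simp only [add_zero]
  have e3 : ∀ m, N + 1 + m = N + (m + 1) := fun m => by ring
  simp only [e3]
  ring

/-- **Submultiplicativity with the surface weight**: `C_{T,N+M}(y) ≤ max(1, y⁻¹) · C_{T,N}(y) · C_{T,M}(y)`.
[cite: MadrasSlade1993, §8.2, (8.2.2)–(8.2.3) (p. 267) and Lemma 1.2.2 (p. 9) — weighted form]
[cite: BeatonBousquetMelouDeGierDuminilCopinGuttmann2014, Proposition 6 (arXiv v5 p. 10: existence of μ_T(y,z) by concatenation)] -/
theorem stripZ_add_le (T N M : ℕ) {y : ℝ} (hy : 0 < y) :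
    stripZ T (N + M) y ≤ yK y * stripZ T N y * stripZ T M y := by
  classical
  have hK := one_le_yK y
  -- pointwise: `y^{V(p)} ≤ K · y^{V₁} · y^{V₂}`
  have hpt : ∀ p ∈ stripPairs T (N + M), y ^ bottomVisits p.1 p.2 (N + M) ≤
      yK y * (y ^ bottomVisits (split N M p).1.1 (split N M p).1.2 N *
        y ^ bottomVisits (split N M p).2.1 (split N M p).2.2 M) := by
    rintro ⟨a, ω⟩ -
    have e := bottomVisits_split a ω N M
    rw [← pow_add, ← e, pow_add]
    split_ifs
    · rw [pow_one]
      calc y ^ bottomVisits a ω (N + M) = y⁻¹ * (y ^ bottomVisits a ω (N + M) * y) := by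
            field_simp
        _ ≤ yK y * (y ^ bottomVisits a ω (N + M) * y) :=
            mul_le_mul_of_nonneg_right (inv_le_yK y) (by positivity)
    · rw [pow_zero, mul_one]
      calc y ^ bottomVisits a ω (N + M) = 1 * y ^ bottomVisits a ω (N + M) := (one_mul _).symm
        _ ≤ yK y * y ^ bottomVisits a ω (N + M) := mul_le_mul_of_nonneg_right hK (by positivity)
  have hnn : ∀ q ∈ stripPairs T N ×ˢ stripPairs T M,
      0 ≤ y ^ bottomVisits q.1.1 q.1.2 N * y ^ bottomVisits q.2.1 q.2.2 M := fun q _ => by positivity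
  calc stripZ T (N + M) y
      ≤ ∑ p ∈ stripPairs T (N + M), yK y * (y ^ bottomVisits (split N M p).1.1 (split N M p).1.2 N *
          y ^ bottomVisits (split N M p).2.1 (split N M p).2.2 M) := Finset.sum_le_sum hpt
    _ = yK y * ∑ q ∈ (stripPairs T (N + M)).image (split N M),
          y ^ bottomVisits q.1.1 q.1.2 N * y ^ bottomVisits q.2.1 q.2.2 M := by
        rw [Finset.mul_sum, Finset.sum_image (split_injOn T N M)]
    _ ≤ yK y * ∑ q ∈ stripPairs T N ×ˢ stripPairs T M,
          y ^ bottomVisits q.1.1 q.1.2 N * y ^ bottomVisits q.2.1 q.2.2 M := by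
        refine mul_le_mul_of_nonneg_left (Finset.sum_le_sum_of_subset_of_nonneg
          (fun q hq => ?_) fun q hq _ => hnn q hq) (by linarith)
        obtain ⟨p, hp, rfl⟩ := Finset.mem_image.1 hq
        exact split_mem hp
    _ = yK y * stripZ T N y * stripZ T M y := by
        rw [Finset.sum_product, stripZ, stripZ, mul_assoc, Finset.sum_mul_sum]

/-! ### The growth rate `μ_T(y)` and the Fekete limit -/

/-- **`μ_T(y) = μ_T(y,1) := inf_N (max(1,y⁻¹) C_{T,N}(y))^{1/N}`** (equal to `lim C_{T,N}(y)^{1/N}`, `tendsto_stripZ_rpow`).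
[cite: BeatonBousquetMelouDeGierDuminilCopinGuttmann2014, Proposition 6 (arXiv v5 p. 10: μ_T(y,z) := lim C_{T,n}(y,z)^{1/n})] -/
def stripMuY (T : ℕ) (y : ℝ) : ℝ := ⨅ n : ℕ, (yK y * stripZ T (n + 1) y) ^ (1 / ((n : ℝ) + 1))

/-- `μ_T(y) ≤ (max(1,y⁻¹) C_{T,n}(y))^{1/n}` for `n ≥ 1`. [cite: BeatonBousquetMelouDeGierDuminilCopinGuttmann2014, Proposition 6 (arXiv v5 p. 10)] -/
theorem stripMuY_le_rpow (T : ℕ) {y : ℝ} (hy : 0 < y) {n : ℕ} (hn : n ≠ 0) :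
    stripMuY T y ≤ (yK y * stripZ T n y) ^ (1 / (n : ℝ)) := by
  obtain ⟨m, rfl⟩ := Nat.exists_eq_succ_of_ne_zero hn
  have hb : BddBelow (Set.range fun m : ℕ => (yK y * stripZ T (m + 1) y) ^ (1 / ((m : ℝ) + 1))) :=
    ⟨0, by
      rintro _ ⟨m, rfl⟩
      exact Real.rpow_nonneg (mul_nonneg (by linarith [one_le_yK y]) (stripZ_pos T _ hy).le) _⟩
  have := ciInf_le hb m
  simpa [stripMuY, Nat.cast_succ] using this

/-- **`μ_T(y)ⁿ ≤ max(1,y⁻¹) C_{T,n}(y)`**. [cite: BeatonBousquetMelouDeGierDuminilCopinGuttmann2014, Proposition 6 (arXiv v5 p. 10)] -/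
theorem pow_stripMuY_le (T n : ℕ) {y : ℝ} (hy : 0 < y) (hμ : 0 ≤ stripMuY T y) :
    stripMuY T y ^ n ≤ yK y * stripZ T n y := by
  have hKZ : 0 ≤ yK y * stripZ T n y := mul_nonneg (by linarith [one_le_yK y]) (stripZ_pos T n hy).le
  rcases Nat.eq_zero_or_pos n with rfl | hn
  · rw [pow_zero]
    have := min_pow_le_stripZ T 0 hy
    rw [zero_add, pow_one] at this
    -- `1 ≤ max(1,y⁻¹) · C_{T,0}(y)` since `C_{T,0}(y) ≥ min(1,y)` and `max(1,y⁻¹) min(1,y) = 1`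
    rcases le_or_gt 1 y with h1 | h1
    · rw [min_eq_left h1] at this
      calc (1 : ℝ) = 1 * 1 := by ring
        _ ≤ yK y * stripZ T 0 y := mul_le_mul (one_le_yK y) this zero_le_one (by linarith [one_le_yK y])
    · rw [min_eq_right h1.le] at this
      calc (1 : ℝ) = y⁻¹ * y := by field_simp
        _ ≤ yK y * stripZ T 0 y := mul_le_mul (inv_le_yK y) this hy.le (by linarith [one_le_yK y])
  · have h := stripMuY_le_rpow T hy hn.ne'
    calc stripMuY T y ^ n ≤ ((yK y * stripZ T n y) ^ (1 / (n : ℝ))) ^ n := pow_le_pow_left₀ hμ h n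
      _ = yK y * stripZ T n y := by rw [one_div, Real.rpow_inv_natCast_pow hKZ hn.ne']

/-- **`C_{T,n}(y)^{1/n} → μ_T(y)`** (Fekete's lemma for `log(max(1,y⁻¹) C_{T,n}(y))`, which is subadditive by
`stripZ_add_le`; `μ_T(y)` is *defined* as the infimum). [cite: BeatonBousquetMelouDeGierDuminilCopinGuttmann2014, Proposition 6 (arXiv v5 p. 10: lim C_{T,n}(y,z)^{1/n} = μ_T(y,z))] -/
theorem tendsto_stripZ_rpow (T : ℕ) {y : ℝ} (hy : 0 < y) :
    Tendsto (fun n : ℕ => (stripZ T n y) ^ (1 / (n : ℝ))) atTop (𝓝 (stripMuY T y)) := by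
  have hK := one_le_yK y
  have hK0 : 0 < yK y := by linarith
  have hpos : ∀ n, 0 < yK y * stripZ T n y := fun n => mul_pos hK0 (stripZ_pos T n hy)
  have hu : Subadditive fun n => Real.log (yK y * stripZ T n y) := by
    intro m n
    rw [← Real.log_mul (hpos m).ne' (hpos n).ne']
    apply Real.log_le_log (hpos _)
    have h := stripZ_add_le T m n hy
    calc yK y * stripZ T (m + n) y ≤ yK y * (yK y * stripZ T m y * stripZ T n y) :=
          mul_le_mul_of_nonneg_left h hK0.le
      _ = yK y * stripZ T m y * (yK y * stripZ T n y) := by ring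
  -- lower bound: `log(K C_n) / n ≥ 2 log(min 1 y)`
  have hmin : 0 < min 1 y := lt_min one_pos hy
  have hbdd : BddBelow (Set.range fun n : ℕ => Real.log (yK y * stripZ T n y) / n) := by
    refine ⟨2 * Real.log (min 1 y), ?_⟩
    rintro _ ⟨n, rfl⟩
    have hlog0 : Real.log (min 1 y) ≤ 0 := Real.log_nonpos hmin.le (min_le_left _ _)
    rcases Nat.eq_zero_or_pos n with rfl | hn
    · simp only [Nat.cast_zero, div_zero]; linarith
    · have h1 : (min 1 y) ^ (n + 1) ≤ yK y * stripZ T n y :=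
        (min_pow_le_stripZ T n hy).trans (le_mul_of_one_le_left (stripZ_pos T n hy).le hK)
      have h2 : ((n : ℝ) + 1) * Real.log (min 1 y) ≤ Real.log (yK y * stripZ T n y) := by
        have := Real.log_le_log (pow_pos hmin _) h1
        rwa [Real.log_pow, Nat.cast_succ] at this
      rw [le_div_iff₀ (by exact_mod_cast hn)]
      have hn1 : (1 : ℝ) ≤ n := by exact_mod_cast hn
      nlinarith
  have hlim := hu.tendsto_lim hbdd
  -- `K^{1/n} → 1`
  have hKlim : Tendsto (fun n : ℕ => (yK y) ^ (1 / (n : ℝ))) atTop (𝓝 1) := by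
    have h1 : Tendsto (fun n : ℕ => Real.log (yK y) / (n : ℝ)) atTop (𝓝 0) :=
      tendsto_const_div_atTop_nhds_zero_nat _
    have h2 := (Real.continuous_exp.tendsto _).comp h1
    rw [Real.exp_zero] at h2
    refine h2.congr fun n => ?_
    rw [Function.comp_apply, Real.rpow_def_of_pos hK0, mul_one_div]
  have key : ∀ n : ℕ, (yK y * stripZ T n y) ^ (1 / (n : ℝ)) = Real.exp (Real.log (yK y * stripZ T n y) / n) :=
    fun n => by rw [Real.rpow_def_of_pos (hpos n), mul_one_div]
  have hexp : Tendsto (fun n : ℕ => (yK y * stripZ T n y) ^ (1 / (n : ℝ))) atTop (𝓝 (Real.exp hu.lim)) := by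
    rw [show (fun n : ℕ => (yK y * stripZ T n y) ^ (1 / (n : ℝ))) =
      fun n => Real.exp (Real.log (yK y * stripZ T n y) / n) from funext key]
    exact (Real.continuous_exp.tendsto _).comp hlim
  -- identify the limit with the infimum
  have hid : Real.exp hu.lim = stripMuY T y := by
    apply le_antisymm
    · refine le_ciInf fun n => ?_
      have h1 := hu.lim_le_div hbdd (Nat.succ_ne_zero n)
      have h2 := Real.exp_le_exp.2 h1
      rw [← key (n + 1)] at h2
      simpa [Nat.cast_succ] using h2
    · refine ge_of_tendsto hexp ?_
      filter_upwards [eventually_ge_atTop 1] with n hn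
      exact stripMuY_le_rpow T hy (by omega)
  -- remove the factor `K^{1/n}`
  have hprod : Tendsto (fun n : ℕ => (yK y)⁻¹ ^ (1 / (n : ℝ)) * (yK y * stripZ T n y) ^ (1 / (n : ℝ))) atTop
      (𝓝 (stripMuY T y)) := by
    have h1 : Tendsto (fun n : ℕ => (yK y)⁻¹ ^ (1 / (n : ℝ))) atTop (𝓝 1) := by
      have := hKlim.inv₀ one_ne_zero
      rw [inv_one] at this
      refine this.congr fun n => ?_
      rw [Real.inv_rpow hK0.le]
    have := h1.mul hexp
    rwa [one_mul, hid] at this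
  refine hprod.congr fun n => ?_
  rw [← Real.mul_rpow (inv_nonneg.2 hK0.le) (hpos n).le, ← mul_assoc, inv_mul_cancel₀ hK0.ne', one_mul]

/-- `0 < μ_T(y)` (indeed `μ_T(y) ≥ min(1,y)²`). [cite: BeatonBousquetMelouDeGierDuminilCopinGuttmann2014, Proposition 6 (arXiv v5 p. 10)] -/
theorem stripMuY_pos (T : ℕ) {y : ℝ} (hy : 0 < y) : 0 < stripMuY T y := by
  have hmin : 0 < min 1 y := lt_min one_pos hy
  have hK := one_le_yK y
  have h : (min 1 y) ^ 2 ≤ stripMuY T y := by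
    refine le_ciInf fun n => ?_
    have h1 : (min 1 y) ^ (n + 1 + 1) ≤ yK y * stripZ T (n + 1) y :=
      (min_pow_le_stripZ T (n + 1) hy).trans (le_mul_of_one_le_left (stripZ_pos T _ hy).le hK)
    have h2 : ((min 1 y) ^ (n + 1 + 1)) ^ (1 / ((n : ℝ) + 1)) ≤ (yK y * stripZ T (n + 1) y) ^ (1 / ((n : ℝ) + 1)) :=
      Real.rpow_le_rpow (pow_nonneg hmin.le _) h1 (by positivity)
    refine le_trans ?_ h2
    rw [← Real.rpow_natCast (min 1 y) (n + 1 + 1), ← Real.rpow_mul hmin.le]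
    have hle1 : min 1 y ≤ 1 := min_le_left _ _
    have hexp : ((n + 1 + 1 : ℕ) : ℝ) * (1 / ((n : ℝ) + 1)) ≤ 2 := by
      rw [mul_one_div, div_le_iff₀ (by positivity)]; push_cast; linarith
    calc (min 1 y) ^ 2 = (min 1 y) ^ (2 : ℝ) := by norm_cast
      _ ≤ (min 1 y) ^ (((n + 1 + 1 : ℕ) : ℝ) * (1 / ((n : ℝ) + 1))) :=
          Real.rpow_le_rpow_of_exponent_ge hmin hle1 hexp
  exact lt_of_lt_of_le (pow_pos hmin 2) h

/-- **`1 ≤ μ_{T}(y)` for `T ≥ 1`** (the walks avoiding the bottom row). [cite: BeatonBousquetMelouDeGierDuminilCopinGuttmann2014, Proposition 6 (arXiv v5 p. 10)] -/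
theorem one_le_stripMuY {T : ℕ} (hT : 1 ≤ T) {y : ℝ} (hy : 0 < y) : 1 ≤ stripMuY T y := by
  refine le_ciInf fun n => ?_
  have h1 : (1 : ℝ) ≤ yK y * stripZ T (n + 1) y :=
    (one_le_stripZ hT (n + 1) hy).trans (le_mul_of_one_le_left (stripZ_pos T _ hy).le (one_le_yK y))
  exact Real.one_le_rpow h1 (by positivity)

/-- `C_{T,n}(y) ≤ C_{T',n}(y)` for `T ≤ T'`. [cite: BeatonBousquetMelouDeGierDuminilCopinGuttmann2014, §3.2 (arXiv v5 p. 11)] -/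
theorem stripZ_mono {T T' : ℕ} (hT : T ≤ T') (n : ℕ) {y : ℝ} (hy : 0 < y) : stripZ T n y ≤ stripZ T' n y := by
  unfold stripZ
  refine Finset.sum_le_sum_of_subset_of_nonneg (fun p hp => ?_) fun p _ _ => pow_nonneg hy.le _
  rw [mem_stripPairs] at hp ⊢
  exact ⟨stripStarts_mono hT hp.1, hp.2.1, hp.2.2.1, fun m hm => (hp.2.2.2 m hm).mono hT⟩

/-- `μ_T(y) ≤ μ_{T'}(y)` for `T ≤ T'`. [cite: BeatonBousquetMelouDeGierDuminilCopinGuttmann2014, Proposition 7 (arXiv v5 p. 11)] -/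
theorem stripMuY_mono {T T' : ℕ} (hT : T ≤ T') {y : ℝ} (hy : 0 < y) : stripMuY T y ≤ stripMuY T' y := by
  refine le_ciInf fun n => ?_
  refine (stripMuY_le_rpow T hy (Nat.succ_ne_zero n)).trans ?_
  rw [Nat.cast_succ]
  have hK0 : 0 ≤ yK y := by linarith [one_le_yK y]
  exact Real.rpow_le_rpow (mul_nonneg hK0 (stripZ_pos T _ hy).le)
    (mul_le_mul_of_nonneg_left (stripZ_mono hT (n + 1) hy) hK0) (by positivity)

end Literature.Probability.RandomPlanarGeometry.SAW.HexBW
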